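import Summits.QuantumFields.YangMills.Theorems.BalabanUVNodesN11Thm2AlongSupplyChainAtBackgrounds

/-!
# DAG node N11 — (2.49)'s UPPER HALF IN THE COR.-3 CHAIN's CONSTANT-COUPLING CURRENCY «−(1∕g_k²)A(U)» FROM THEOREM 2 KEYED: the `h249up` input of dag-n13-w3's asymmetric
# N11 → N13 junction (`…N13Cor3AsymJunctionAtRecord13CoPH`, which reads g0 FILE 1's `action23_at_record₁₃CoPH_le_of_thm2` with per-scale binders displayed) with the Theorem-2
# binders DISCHARGED from the keyed carrier sentence and — along dag-n11-e's chain — the 𝐁-side from `ChainFormAt` + row `bg`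

Cell `pub-ymgap`, YM-PLAN Track A (HUMAN RULING D-0062 ∕ D-0149), seat `pub-ymgap-dag-n11-w2` (g2), route `BalabanUVNodes`, key item K1⁷ `StabilityBAtRecordR13SepCoPH` =
stmt-QuantumFields-20542 (helper, count-neutral).  [III] = [Balaban1988Convergent].  Over g0 FILE 1 (`action23_at_record₁₃CoPH_le_of_thm2`), g2's keyed Defs ∕ `…Thm2OfRecordKeyed`
(`h243_of_ineq243_keyed`, `h244_of_ineq244_keyed`, `h243_mono_vol`, `h244_mono_vol`, `exists_nonneg_constants_of_thm2Printed_keyed`), `…Thm2AlongSupplyChain` (`h248_chainWitness_of_chainFormAt`),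
`…AtBackgrounds` (`regular_of_bgProvisoΛ`), dag-n11-e's `chainFormAt_all_of_obligations`.

WHY THIS FILE.  dag-n13-w3's junction (p589816 ∕ p591353 ∕ p592785) serves [III] Cor. 3's END theorem in the ASYMMETRIC shape: the UPPER half of (2.49) at every configuration in
constant-coupling currency, `A_k(s)(U) ≤ −(1∕g_k²)·A(U) − EkLog + C·Σ_n Γ_n`, produced from g0 FILE 1's `action23_at_record₁₃CoPH_le_of_thm2` — whose Theorem-2 binders `h243 ∕ h244`
and (2.48) binder `h248` stay displayed there.  THIS FILE discharges them exactly as g2's two-sided files do: `h243 ∕ h244` from `B14Thm2.Ineq243 ∕ Ineq244` on the KEYED carrier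
(one sentence each, or `B14.Thm2Printed` keyed), `h248` along the chain from `ChainFormAt θ p σ k` + the (2.41)(ii) membership (row `bg` at the backgrounds of a reading support).
Displayed stay, as printed: `β_j ≥ 0` (the DAG's unprinted `betaPositive` leaf, located), `φ_j ≤ 1` (def-T's cut-offs), (2.46)'s coupling inputs, the vacuum sentence.

WHAT THIS FILE PROVES (0 `sorry`, 0 `def`, standard axioms; count-neutral; nothing of Bałaban's asserted).
★ `action23_le_of_ineq243_ineq244_keyed` (generic keyed carrier `(𝒯, 𝒰)`: the upper half at every datum `(k ≤ K, s, U ∈ 𝒰 k s)`, volumes `Γ_n ≥ |Γ_n(s)|`, `h248` displayed) ·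
★ `action23_le_of_thm2Printed_keyed` (`B14.Thm2Printed` keyed ⇒ `∃ E₁ R₁ ≥ 0`, the same under (2.46)'s `R₁`-smallness) · ★★ `action23_chainWitness_le_of_obligations` (along the chain
on the live-selector line: `(hσ, hT)` + provisos + Theorem 2 keyed to the chain at a (2.41)(ii)-regular class ⇒ `∃ E₁ R₁ ≥ 0`, ∀ k ≤ K, s, U ∈ 𝒰 k s: the upper half with
`C = E₁(1−L^{−β})⁻¹ + 1 + 2·θ.s2.lf.B₀·K₀(4·2^d,2d) + E₂`, volumes ≥ |Γ_n(s)| and ≥ #ring_n(s)) · ★★ `action23_chainWitness_le_at_backgrounds_of_obligations` (the class = backgrounds of a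
reading support, regularity = row `bg`) — dag-n13-w3's `h249up` input at `U := Ubg k s W`, every token a named row.
§3 the all-small branch: ★ `ineq249_constCoupling_of_ineq243_ineq244_keyed_of_phi_eq_one` (both halves with the constant coupling `(1∕g_k²)·A(U)` when `φ_j ≡ 1`, generic keyed
carrier; g0 FILE 11's `…_constCoupling_of_phi_eq_one` with `h243 ∕ h244` discharged) · ★★ `ineq249_constCoupling_chainWitness_of_obligations_of_phi_eq_one` (along the chain, 𝐁-side
discharged) — dag-n13-w3's `h249low` socket on the all-small branch.

HONEST FRAMING.  Kernel composition; Theorem 2 (keyed), obligations, row `bg`, provisos, `β_j ≥ 0`, `φ_j ≤ 1`, (2.46)'s inputs and the vacuum sentence are HYPOTHESES; nothing of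
Bałaban asserted; the identification `hA'eq` of dag-n13-w3's junction (what the (1.72) representation of `densOfRecord₁₃` IS) is untouched; N11 ∕ N13 NOT discharged; K1⁷ NOT
closed; counts unmoved (typed 28∕28 · discharged 5∕27).  One finite four-torus programme at fixed `ε = L^{−K}`; R4 closes only the conditional finite-𝕋⁴ rung `BalabanLadder.UV`;
NOT ℝ⁴, NOT OS, NOT the Yang–Mills mass gap (Clay), which none of this proves.
Sources: [III] Thm 2 p.263, (2.45)–(2.50) pp.263–264, (2.23)–(2.24) pp.258–259, (2.41)–(2.42) p.261; [Balaban1989LargeFieldII] p.391 (asymmetric use).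
-/

noncomputable section

open scoped BigOperators Matrix.Norms.L2Operator

namespace Summit.QuantumFields.YangMills.Theorems.BalabanUVNodesN11Thm2AlongSupplyChainUpperHalf

open Literature.MathematicalPhysics.QuantumFieldTheory.Balaban1983to89 Step B14.Eq225Concrete B14.LocalCoupling B14Thm2 B12TreeDecay TreeLengthTorus Finset
open T4Continuum Node00 B15DeterminingSets
open B10Eq38TorusDomains (toFine)
open BalabanUVNodesN11Sect3SupplyChainDefs (Sect3Supplier chainWitness)
open BalabanUVNodesN11Sect3SupplyChainObligationsDefs (ChainFormAt SupplierObligations NoExpansionObligation chainFormAt_all_of_obligations)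
open BalabanUVNodesN11Thm2Sect2DataOfRecordKeyedDefs (sect2DataOfRecord₁₃Keyed h243_of_ineq243_keyed h244_of_ineq244_keyed)
open BalabanUVNodesN11Thm2OfRecordKeyed (h243_mono_vol h244_mono_vol exists_nonneg_constants_of_thm2Printed_keyed)
open BalabanUVNodesN11Thm2Ineq249AtRecord13CoPH (action23_at_record₁₃CoPH_le_of_thm2)
open BalabanUVNodesN11Thm2AlongSupplyChain (h248_chainWitness_of_chainFormAt)
open BalabanUVNodesN11Thm2AlongSupplyChainAtBackgrounds (regular_of_bgProvisoΛ)

variable {F : T4Family} {N : ℕ} [NeZero N]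
variable (θ : Stage13HParams F N) (p : B12.RunParams)
variable (𝒯 : (k : ℕ) → SeqOfRecord F θ.ν θ.τ9.M (gOfRecord₁₃ F N θ.toStage13Params p) p.K k → Sect2.TermValues (F.P p.K) (MatA N) (FluctV N) θ.τ9.M)
variable (𝒰 : (k : ℕ) → SeqOfRecord F θ.ν θ.τ9.M (gOfRecord₁₃ F N θ.toStage13Params p) p.K k → Set (GaugeField (F.P p.K) 0 (SU N)))

/-! ## §1. On the generic keyed carrier -/

open Classical in
/-- **★ THE UPPER HALF OF (2.49), CONSTANT-COUPLING CURRENCY, FROM (2.43) ∧ (2.44) ON THE KEYED CARRIER** at every datum `(k ≤ K, s, U ∈ 𝒰 k s)`, witness `𝒯 k s`, volumes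
`Γ_n ≥ |Γ_n(s)|`: `A_k(s)(U) ≤ −(1∕g_k²)·A(U) − EkLog + (E₁(1−L^{−β})⁻¹ + 1 + 2B₁ + E₂)·Σ_{n=1}^{k} Γ_n` — g0 FILE 1's `action23_at_record₁₃CoPH_le_of_thm2` with `h243 ∕ h244`
DISCHARGED; displayed: `β_j ≥ 0`, `φ_j ≤ 1`, (2.48) `h248`, (2.46)'s inputs, vacuum. [cite: Balaban1988Convergent, (2.49)–(2.50) p.264, (2.24) p.259, Thm 2 p.263] -/
theorem action23_le_of_ineq243_ineq244_keyed {L β E₁ R₁ : ℝ} {κ₀ : ℕ}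
    (h243K : Ineq243 (sect2DataOfRecord₁₃Keyed θ p 𝒯 𝒰) L β E₁) (h244K : Ineq244 (sect2DataOfRecord₁₃Keyed θ p 𝒯 𝒰) R₁ κ₀)
    (hL : 1 < L) (hβ : 0 < β) (hE : 0 ≤ E₁) (hR : 0 ≤ R₁) (hκ : 7 ≤ κ₀)
    {k : ℕ} (hk : k ≤ p.K) (s : SeqOfRecord F θ.ν θ.τ9.M (gOfRecord₁₃ F N θ.toStage13Params p) p.K k) (U : GaugeField (F.P p.K) 0 (SU N)) (hU : U ∈ 𝒰 k s)
    (hg : ∀ j, j ≤ p.K → 0 ≤ gOfRecord₁₃ F N θ.toStage13Params p j)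
    (hβj : ∀ j, 1 ≤ j → j ≤ k → 0 ≤ 1 / gOfRecord₁₃ F N θ.toStage13Params p (j - 1) ^ 2 - 1 / gOfRecord₁₃ F N θ.toStage13Params p j ^ 2)
    (hφ : ∀ j, 1 ≤ j → j ≤ k → ∀ x, θ.Phih p k s.Ω s.Λ j x ≤ 1)
    (a : Tk.SFluct (F.P p.K) (FluctV N)) (Ek EkLog EkRest : ℝ) (hEk : Ek = EkLog + EkRest) (B₁ E₂ : ℝ) (Γ : ℕ → ℝ)
    (hΓ : ∀ n, 1 ≤ n → n ≤ k → ((univ.filter fun y : Site (F.P p.K) n => toFine n y ∈ gammaRegion s.Ω k n).card : ℝ) ≤ Γ n)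
    (hsum : ∀ n, 1 ≤ n → n ≤ k → ∑ j ∈ Icc 1 n, (gOfRecord₁₃ F N θ.toStage13Params p j) ^ κ₀ ≤ (gOfRecord₁₃ F N θ.toStage13Params p n) ^ (κ₀ - 6))
    (hsmall : ∀ n, 1 ≤ n → n ≤ k → R₁ * (gOfRecord₁₃ F N θ.toStage13Params p n) ^ (κ₀ - 6) ≤ 1)
    (h248 : |B240 (sect2TowerOfRecord F N (FluctV N) p.K (settingOfRecord₁₃ F N θ.toStage13Params p) (θ.rzAt p s) s (𝒯 k s))
        (fun j X => Sect2.admB (F.P p.K) θ.ν θ.τ9.M (gOfRecord₁₃ F N θ.toStage13Params p) s.Ω s.Λ j (Sect2.domSites (F.P p.K) θ.τ9.M j X)) a k U| ≤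
      2 * B₁ * ∑ n ∈ Icc 1 k, Γ n)
    (hvac : VacuumRestBound EkRest E₂ Γ k) :
    (sect2ActionDataOfRecord F N (FluctV N) p.K (settingOfRecord₁₃ F N θ.toStage13Params p) (θ.rzAt p s) s (𝒯 k s) a Ek).action23 k U ≤
      -(1 / (gOfRecord₁₃ F N θ.toStage13Params p k) ^ 2 * wilsonAction4 U) - EkLog + (E₁ * (1 - L ^ (-β))⁻¹ + 1 + 2 * B₁ + E₂) * ∑ n ∈ Icc 1 k, Γ n :=
  have hL0 : 0 ≤ L := le_of_lt (lt_trans zero_lt_one hL)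
  have hΓ0 : ∀ n, 1 ≤ n → n ≤ k → 0 ≤ Γ n := fun n hn hnk => (Nat.cast_nonneg _).trans (hΓ n hn hnk)
  action23_at_record₁₃CoPH_le_of_thm2 θ p s (𝒯 k s) a κ₀ hκ Ek EkLog EkRest hEk U E₁ R₁ B₁ L β E₂ Γ hL hβ hE hR hΓ0 hβj hφ
    (fun j hj hjk => h243_mono_vol hE hL0 hj hΓ (h243_of_ineq243_keyed θ p 𝒯 𝒰 h243K hk s U hU j hj hjk))
    (fun j hj hjk => h244_mono_vol hR (hg j (hjk.trans hk)) hj hΓ (h244_of_ineq244_keyed θ p 𝒯 𝒰 h244K hk s U hU j hj hjk)) hsum hsmall h248 hvac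

open Classical in
/-- **★ … FROM `B14.Thm2Printed` KEYED** (`0 < β < 1`, `1 < L`, `κ₀ ≥ 7`, `H033` at the run's flow, couplings `≥ 0`): `∃ E₁ R₁ ≥ 0` with the upper half at every datum under (2.46)'s
`R₁`-smallness, `β_j ≥ 0`, `φ_j ≤ 1`, (2.48) and the vacuum sentence. [cite: Balaban1988Convergent, Thm 2 p.263, (2.49)–(2.50) p.264] -/
theorem action23_le_of_thm2Printed_keyed (H033 : Flow → ℕ → Prop) {L β : ℝ} {κ₀ : ℕ}
    (h : B14.Thm2Printed H033 (fun _ : PUnit => sect2DataOfRecord₁₃Keyed θ p 𝒯 𝒰) L β κ₀) (hβ1 : β < 1) (hβ0 : 0 < β) (hL : 1 < L) (hκ : 7 ≤ κ₀)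
    (h033 : H033 (flowOfRun (gOfRecord₁₃ F N θ.toStage13Params p)) p.K) (hg : ∀ j, j ≤ p.K → 0 ≤ gOfRecord₁₃ F N θ.toStage13Params p j) :
    ∃ E₁ R₁ : ℝ, 0 ≤ E₁ ∧ 0 ≤ R₁ ∧
      ∀ k, k ≤ p.K → ∀ (s : SeqOfRecord F θ.ν θ.τ9.M (gOfRecord₁₃ F N θ.toStage13Params p) p.K k) (U : GaugeField (F.P p.K) 0 (SU N)), U ∈ 𝒰 k s →
      (∀ j, 1 ≤ j → j ≤ k → 0 ≤ 1 / gOfRecord₁₃ F N θ.toStage13Params p (j - 1) ^ 2 - 1 / gOfRecord₁₃ F N θ.toStage13Params p j ^ 2) →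
      (∀ j, 1 ≤ j → j ≤ k → ∀ x, θ.Phih p k s.Ω s.Λ j x ≤ 1) →
      ∀ (a : Tk.SFluct (F.P p.K) (FluctV N)) (Ek EkLog EkRest : ℝ), Ek = EkLog + EkRest → ∀ (B₁ E₂ : ℝ) (Γ : ℕ → ℝ),
      (∀ n, 1 ≤ n → n ≤ k → ((univ.filter fun y : Site (F.P p.K) n => toFine n y ∈ gammaRegion s.Ω k n).card : ℝ) ≤ Γ n) →
      (∀ n, 1 ≤ n → n ≤ k → ∑ j ∈ Icc 1 n, (gOfRecord₁₃ F N θ.toStage13Params p j) ^ κ₀ ≤ (gOfRecord₁₃ F N θ.toStage13Params p n) ^ (κ₀ - 6)) →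
      (∀ n, 1 ≤ n → n ≤ k → R₁ * (gOfRecord₁₃ F N θ.toStage13Params p n) ^ (κ₀ - 6) ≤ 1) →
      |B240 (sect2TowerOfRecord F N (FluctV N) p.K (settingOfRecord₁₃ F N θ.toStage13Params p) (θ.rzAt p s) s (𝒯 k s))
          (fun j X => Sect2.admB (F.P p.K) θ.ν θ.τ9.M (gOfRecord₁₃ F N θ.toStage13Params p) s.Ω s.Λ j (Sect2.domSites (F.P p.K) θ.τ9.M j X)) a k U| ≤
        2 * B₁ * ∑ n ∈ Icc 1 k, Γ n →
      VacuumRestBound EkRest E₂ Γ k →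
      (sect2ActionDataOfRecord F N (FluctV N) p.K (settingOfRecord₁₃ F N θ.toStage13Params p) (θ.rzAt p s) s (𝒯 k s) a Ek).action23 k U ≤
        -(1 / (gOfRecord₁₃ F N θ.toStage13Params p k) ^ 2 * wilsonAction4 U) - EkLog + (E₁ * (1 - L ^ (-β))⁻¹ + 1 + 2 * B₁ + E₂) * ∑ n ∈ Icc 1 k, Γ n := by
  obtain ⟨E₁, R₁, hE, hR, h243K, h244K⟩ :=
    exists_nonneg_constants_of_thm2Printed_keyed θ p 𝒯 𝒰 H033 h hβ1 h033 (le_of_lt (lt_trans zero_lt_one hL)) hg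
  exact ⟨E₁, R₁, hE, hR, fun k hk s U hU hβj hφ a Ek EkLog EkRest hEk B₁ E₂ Γ hΓ hsum hsmall h248 hvac =>
    action23_le_of_ineq243_ineq244_keyed θ p 𝒯 𝒰 h243K h244K hL hβ0 hE hR hκ hk s U hU hg hβj hφ a Ek EkLog EkRest hEk B₁ E₂ Γ hΓ hsum hsmall h248 hvac⟩

/-! ## §2. Along the chain: the 𝐁-side discharged -/

open Classical in
/-- **★★ THE UPPER HALF ALONG THE WITNESS CHAIN ON THE LIVE-SELECTOR LINE**: `(hσ, hT)` + def-T's provisos + Theorem 2 keyed to the chain at a (2.41)(ii)-regular class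
`𝒰` + `0 < β < 1`, `1 < L`, `κ₀ ≥ 7`, `H033`, `g_j ≥ 0`, `κ₀(4·2^d,2d) ≤ θ.s2.lf.κ` ⇒ `∃ E₁ R₁ ≥ 0`, ∀ `k ≤ K`, `s`, `U ∈ 𝒰 k s`: under `β_j ≥ 0`, `φ_j ≤ 1`, volumes dominating
`|Γ_n(s)|` and `#ring_n(s)`, (2.46)'s inputs and the vacuum sentence, `A_k(s)(U) ≤ −(1∕g_k²)·A(U) − EkLog + (E₁(1−L^{−β})⁻¹ + 1 + 2·θ.s2.lf.B₀·K₀(4·2^d,2d) + E₂)·Σ_n Γ_n` for the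
chain's (2.23)-action — the (2.48) binder DISCHARGED (`h248_chainWitness_of_chainFormAt` ∘ `chainFormAt_all_of_obligations`). [cite: Balaban1988Convergent, (2.49)–(2.50) p.264, Thm 1 p.262, Thm 2 p.263] -/
theorem action23_chainWitness_le_of_obligations (σ : Sect3Supplier θ p) (hprov : θ.Provisos₁₃CoPH F N)
    (hsel : θ.ppSel = ppSelLiveOfRecord F N θ.ν θ.τ9 (EOfRecord₁₃ F N θ.toStage13Params) (wOfRecord₉ F N θ.toStage9Params))
    (hθ : θ.Admissible F N) (hE₀ : 0 ≤ θ.s2.lf.E₀) (hB₀ : 0 ≤ θ.s2.lf.B₀) (hM : 1 ≤ θ.τ9.M)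
    (hκ : kappa₀ (4 * 2 ^ (F.P p.K).d) (2 * (F.P p.K).d) ≤ θ.s2.lf.κ)
    (hσ : SupplierObligations θ p σ) (hT : NoExpansionObligation θ p σ)
    (H033 : Flow → ℕ → Prop) {L β : ℝ} {κ₀ : ℕ}
    (hT2 : B14.Thm2Printed H033 (fun _ : PUnit => sect2DataOfRecord₁₃Keyed θ p (fun k s => (chainWitness θ p σ k).1 s) 𝒰) L β κ₀)
    (hβ1 : β < 1) (hβ0 : 0 < β) (hL : 1 < L) (hκ7 : 7 ≤ κ₀)
    (h033 : H033 (flowOfRun (gOfRecord₁₃ F N θ.toStage13Params p)) p.K) (hg : ∀ j, j ≤ p.K → 0 ≤ gOfRecord₁₃ F N θ.toStage13Params p j)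
    (h𝒰 : ∀ k (s : SeqOfRecord F θ.ν θ.τ9.M (gOfRecord₁₃ F N θ.toStage13Params p) p.K k) (U : GaugeField (F.P p.K) 0 (SU N)), U ∈ 𝒰 k s →
      ∀ j, 1 ≤ j → j ≤ k → ∀ X, Sect2.admB (F.P p.K) θ.ν θ.τ9.M (gOfRecord₁₃ F N θ.toStage13Params p) s.Ω s.Λ j (Sect2.domSites (F.P p.K) θ.τ9.M j X) = true →
        Sect2.ofBackgroundC (ιSU N) U ∈ Sect2.spaceMS (settingOfRecord₁₃ F N θ.toStage13Params p) (θ.rzAt p s) θ.τ9.M j (Sect2.domSites (F.P p.K) θ.τ9.M j X) s.Ω) :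
    ∃ E₁ R₁ : ℝ, 0 ≤ E₁ ∧ 0 ≤ R₁ ∧
      ∀ k, k ≤ p.K → ∀ (s : SeqOfRecord F θ.ν θ.τ9.M (gOfRecord₁₃ F N θ.toStage13Params p) p.K k) (U : GaugeField (F.P p.K) 0 (SU N)), U ∈ 𝒰 k s →
      (∀ j, 1 ≤ j → j ≤ k → 0 ≤ 1 / gOfRecord₁₃ F N θ.toStage13Params p (j - 1) ^ 2 - 1 / gOfRecord₁₃ F N θ.toStage13Params p j ^ 2) →
      (∀ j, 1 ≤ j → j ≤ k → ∀ x, θ.Phih p k s.Ω s.Λ j x ≤ 1) →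
      ∀ (a : Tk.SFluct (F.P p.K) (FluctV N)) (Ek EkLog EkRest : ℝ), Ek = EkLog + EkRest → ∀ (E₂ : ℝ) (Γ : ℕ → ℝ),
      (∀ n, 1 ≤ n → n ≤ k → ((univ.filter fun y : Site (F.P p.K) n => toFine n y ∈ gammaRegion s.Ω k n).card : ℝ) ≤ Γ n) →
      (∀ n, 1 ≤ n → n ≤ k →
        ((univ.filter fun c : TPt (F.P p.K).d (Sect2.domCount (F.P p.K) θ.τ9.M n) =>
            (Sect2.domSites (F.P p.K) θ.τ9.M n (Sect2.cubeDom (F.P p.K) θ.τ9.M n c) ∩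
                Sect2.enlT (F.P p.K) (Sect2.zSide (F.P p.K) θ.ν θ.τ9.M (gOfRecord₁₃ F N θ.toStage13Params p) n) 1 (s.Λ n)ᶜ).Nonempty ∧
              ∃ c', (c' = c ∨ TAdj c' c) ∧ (Sect2.domSites (F.P p.K) θ.τ9.M n (Sect2.cubeDom (F.P p.K) θ.τ9.M n c') ∩ s.Ω n).Nonempty).card : ℝ) ≤ Γ n) →
      (∀ n, 1 ≤ n → n ≤ k → ∑ j ∈ Icc 1 n, (gOfRecord₁₃ F N θ.toStage13Params p j) ^ κ₀ ≤ (gOfRecord₁₃ F N θ.toStage13Params p n) ^ (κ₀ - 6)) →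
      (∀ n, 1 ≤ n → n ≤ k → R₁ * (gOfRecord₁₃ F N θ.toStage13Params p n) ^ (κ₀ - 6) ≤ 1) →
      VacuumRestBound EkRest E₂ Γ k →
      (sect2ActionDataOfRecord F N (FluctV N) p.K (settingOfRecord₁₃ F N θ.toStage13Params p) (θ.rzAt p s) s ((chainWitness θ p σ k).1 s) a Ek).action23 k U ≤
        -(1 / (gOfRecord₁₃ F N θ.toStage13Params p k) ^ 2 * wilsonAction4 U) - EkLog +
          (E₁ * (1 - L ^ (-β))⁻¹ + 1 + 2 * (θ.s2.lf.B₀ * K₀ (4 * 2 ^ (F.P p.K).d) (2 * (F.P p.K).d)) + E₂) * ∑ n ∈ Icc 1 k, Γ n := by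
  have hκ0 : 0 ≤ θ.s2.lf.κ := (kappa₀_nonneg (by positivity) _).trans hκ
  obtain ⟨E₁, R₁, hE, hR, hall⟩ :=
    action23_le_of_thm2Printed_keyed θ p (fun k s => (chainWitness θ p σ k).1 s) 𝒰 H033 hT2 hβ1 hβ0 hL hκ7 h033 hg
  refine ⟨E₁, R₁, hE, hR, fun k hk s U hU hβj hφ a Ek EkLog EkRest hEk E₂ Γ hΓ hΓr hsum hsmall hvac => ?_⟩
  have hkmK : k ≤ (F.P p.K).m + (F.P p.K).K := by rw [T4Family.P_K]; omega
  have hform : ChainFormAt θ p σ k := chainFormAt_all_of_obligations hprov hsel hθ hκ0 hE₀ hB₀ hM σ hσ hT k hk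
  exact hall k hk s U hU hβj hφ a Ek EkLog EkRest hEk _ E₂ Γ hΓ hsum hsmall
    (h248_chainWitness_of_chainFormAt θ p σ hform s a U hkmK hM hκ hB₀ (h𝒰 k s U hU) Γ hΓr) hvac

variable (Supp : (k : ℕ) → SeqOfRecord F θ.ν θ.τ9.M (gOfRecord₁₃ F N θ.toStage13Params p) p.K k → Set (MSField (F.P p.K) (SU N)))
variable (Ubg : (k : ℕ) → SeqOfRecord F θ.ν θ.τ9.M (gOfRecord₁₃ F N θ.toStage13Params p) p.K k → BgMap F N p.K)

open Classical in
/-- **★★ THE UPPER HALF AT THE BACKGROUNDS OF A READING SUPPORT — dag-n13-w3's `h249up` input at `U := Ubg k s W`**, every token a named row: provisos, live selector,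
admissibility, signs, `(hσ, hT)`, def-R's row `bg` at every level, Theorem 2 keyed to the chain at the backgrounds, the printed guards; then per datum `β_j ≥ 0`, `φ_j ≤ 1`,
volumes, (2.46)'s inputs, vacuum. [cite: Balaban1988Convergent, (2.49)–(2.50) p.264, Thm 2 p.263 L14, (2.41) p.261] -/
theorem action23_chainWitness_le_at_backgrounds_of_obligations (σ : Sect3Supplier θ p) (hprov : θ.Provisos₁₃CoPH F N)
    (hsel : θ.ppSel = ppSelLiveOfRecord F N θ.ν θ.τ9 (EOfRecord₁₃ F N θ.toStage13Params) (wOfRecord₉ F N θ.toStage9Params))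
    (hθ : θ.Admissible F N) (hE₀ : 0 ≤ θ.s2.lf.E₀) (hB₀ : 0 ≤ θ.s2.lf.B₀) (hM : 1 ≤ θ.τ9.M)
    (hκ : kappa₀ (4 * 2 ^ (F.P p.K).d) (2 * (F.P p.K).d) ≤ θ.s2.lf.κ)
    (hσ : SupplierObligations θ p σ) (hT : NoExpansionObligation θ p σ)
    (hbg : ∀ k, BgProvisoΛ F N p.K (settingOfRecord₁₃ F N θ.toStage13Params p) (θ.Rz p.K) θ.τ9.M k (Supp k) (Ubg k))
    (H033 : Flow → ℕ → Prop) {L β : ℝ} {κ₀ : ℕ}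
    (hT2 : B14.Thm2Printed H033 (fun _ : PUnit => sect2DataOfRecord₁₃Keyed θ p (fun k s => (chainWitness θ p σ k).1 s) (fun k s => Ubg k s '' Supp k s)) L β κ₀)
    (hβ1 : β < 1) (hβ0 : 0 < β) (hL : 1 < L) (hκ7 : 7 ≤ κ₀)
    (h033 : H033 (flowOfRun (gOfRecord₁₃ F N θ.toStage13Params p)) p.K) (hg : ∀ j, j ≤ p.K → 0 ≤ gOfRecord₁₃ F N θ.toStage13Params p j) :
    ∃ E₁ R₁ : ℝ, 0 ≤ E₁ ∧ 0 ≤ R₁ ∧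
      ∀ k, k ≤ p.K → ∀ (s : SeqOfRecord F θ.ν θ.τ9.M (gOfRecord₁₃ F N θ.toStage13Params p) p.K k) (W : MSField (F.P p.K) (SU N)), W ∈ Supp k s →
      (∀ j, 1 ≤ j → j ≤ k → 0 ≤ 1 / gOfRecord₁₃ F N θ.toStage13Params p (j - 1) ^ 2 - 1 / gOfRecord₁₃ F N θ.toStage13Params p j ^ 2) →
      (∀ j, 1 ≤ j → j ≤ k → ∀ x, θ.Phih p k s.Ω s.Λ j x ≤ 1) →
      ∀ (a : Tk.SFluct (F.P p.K) (FluctV N)) (Ek EkLog EkRest : ℝ), Ek = EkLog + EkRest → ∀ (E₂ : ℝ) (Γ : ℕ → ℝ),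
      (∀ n, 1 ≤ n → n ≤ k → ((univ.filter fun y : Site (F.P p.K) n => toFine n y ∈ gammaRegion s.Ω k n).card : ℝ) ≤ Γ n) →
      (∀ n, 1 ≤ n → n ≤ k →
        ((univ.filter fun c : TPt (F.P p.K).d (Sect2.domCount (F.P p.K) θ.τ9.M n) =>
            (Sect2.domSites (F.P p.K) θ.τ9.M n (Sect2.cubeDom (F.P p.K) θ.τ9.M n c) ∩
                Sect2.enlT (F.P p.K) (Sect2.zSide (F.P p.K) θ.ν θ.τ9.M (gOfRecord₁₃ F N θ.toStage13Params p) n) 1 (s.Λ n)ᶜ).Nonempty ∧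
              ∃ c', (c' = c ∨ TAdj c' c) ∧ (Sect2.domSites (F.P p.K) θ.τ9.M n (Sect2.cubeDom (F.P p.K) θ.τ9.M n c') ∩ s.Ω n).Nonempty).card : ℝ) ≤ Γ n) →
      (∀ n, 1 ≤ n → n ≤ k → ∑ j ∈ Icc 1 n, (gOfRecord₁₃ F N θ.toStage13Params p j) ^ κ₀ ≤ (gOfRecord₁₃ F N θ.toStage13Params p n) ^ (κ₀ - 6)) →
      (∀ n, 1 ≤ n → n ≤ k → R₁ * (gOfRecord₁₃ F N θ.toStage13Params p n) ^ (κ₀ - 6) ≤ 1) →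
      VacuumRestBound EkRest E₂ Γ k →
      (sect2ActionDataOfRecord F N (FluctV N) p.K (settingOfRecord₁₃ F N θ.toStage13Params p) (θ.rzAt p s) s ((chainWitness θ p σ k).1 s) a Ek).action23 k (Ubg k s W) ≤
        -(1 / (gOfRecord₁₃ F N θ.toStage13Params p k) ^ 2 * wilsonAction4 (Ubg k s W)) - EkLog +
          (E₁ * (1 - L ^ (-β))⁻¹ + 1 + 2 * (θ.s2.lf.B₀ * K₀ (4 * 2 ^ (F.P p.K).d) (2 * (F.P p.K).d)) + E₂) * ∑ n ∈ Icc 1 k, Γ n := by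
  obtain ⟨E₁, R₁, hE, hR, hall⟩ := action23_chainWitness_le_of_obligations θ p (fun k s => Ubg k s '' Supp k s) σ hprov hsel hθ hE₀ hB₀ hM hκ hσ hT
    H033 hT2 hβ1 hβ0 hL hκ7 h033 hg (regular_of_bgProvisoΛ θ p Supp Ubg hbg)
  exact ⟨E₁, R₁, hE, hR, fun k hk s W hW => hall k hk s (Ubg k s W) ⟨W, hW, rfl⟩⟩

/-! ## §3. The all-small history: BOTH halves with the constant coupling (dag-n13-w3's `h249low ∕ h249up` socket) -/

open Classical in
/-- **★ BOTH HALVES OF (2.49) WITH THE CONSTANT COUPLING ON AN ALL-SMALL HISTORY** (`φ_j ≡ 1`, `j ≤ k` — p. 259 «g_j²(x) = g_j² on the last domain») **FROM (2.43) ∧ (2.44) ON THE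
KEYED CARRIER** at every datum, volumes `Γ_n ≥ |Γ_n(s)|`: g0 FILE 11's `ineq249_action23_at_record₁₃CoPH_constCoupling_of_phi_eq_one` with `h243 ∕ h244` DISCHARGED; (2.48), (2.46)'s
inputs and the vacuum sentence displayed. [cite: Balaban1988Convergent, (2.49)–(2.50) p.264, (2.24) p.259, Thm 2 p.263] -/
theorem ineq249_constCoupling_of_ineq243_ineq244_keyed_of_phi_eq_one {L β E₁ R₁ : ℝ} {κ₀ : ℕ}
    (h243K : Ineq243 (sect2DataOfRecord₁₃Keyed θ p 𝒯 𝒰) L β E₁) (h244K : Ineq244 (sect2DataOfRecord₁₃Keyed θ p 𝒯 𝒰) R₁ κ₀)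
    (hL : 1 < L) (hβ : 0 < β) (hE : 0 ≤ E₁) (hR : 0 ≤ R₁) (hκ : 7 ≤ κ₀)
    {k : ℕ} (hk : k ≤ p.K) (s : SeqOfRecord F θ.ν θ.τ9.M (gOfRecord₁₃ F N θ.toStage13Params p) p.K k) (U : GaugeField (F.P p.K) 0 (SU N)) (hU : U ∈ 𝒰 k s)
    (hg : ∀ j, j ≤ p.K → 0 ≤ gOfRecord₁₃ F N θ.toStage13Params p j)
    (hφ1 : ∀ j, 1 ≤ j → j ≤ k → ∀ x, θ.Phih p k s.Ω s.Λ j x = 1)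
    (a : Tk.SFluct (F.P p.K) (FluctV N)) (Ek EkLog EkRest : ℝ) (hEk : Ek = EkLog + EkRest) (B₁ E₂ : ℝ) (Γ : ℕ → ℝ)
    (hΓ : ∀ n, 1 ≤ n → n ≤ k → ((univ.filter fun y : Site (F.P p.K) n => toFine n y ∈ gammaRegion s.Ω k n).card : ℝ) ≤ Γ n)
    (hsum : ∀ n, 1 ≤ n → n ≤ k → ∑ j ∈ Icc 1 n, (gOfRecord₁₃ F N θ.toStage13Params p j) ^ κ₀ ≤ (gOfRecord₁₃ F N θ.toStage13Params p n) ^ (κ₀ - 6))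
    (hsmall : ∀ n, 1 ≤ n → n ≤ k → R₁ * (gOfRecord₁₃ F N θ.toStage13Params p n) ^ (κ₀ - 6) ≤ 1)
    (h248 : |B240 (sect2TowerOfRecord F N (FluctV N) p.K (settingOfRecord₁₃ F N θ.toStage13Params p) (θ.rzAt p s) s (𝒯 k s))
        (fun j X => Sect2.admB (F.P p.K) θ.ν θ.τ9.M (gOfRecord₁₃ F N θ.toStage13Params p) s.Ω s.Λ j (Sect2.domSites (F.P p.K) θ.τ9.M j X)) a k U| ≤
      2 * B₁ * ∑ n ∈ Icc 1 k, Γ n)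
    (hvac : VacuumRestBound EkRest E₂ Γ k) :
    Ineq249 ((sect2ActionDataOfRecord F N (FluctV N) p.K (settingOfRecord₁₃ F N θ.toStage13Params p) (θ.rzAt p s) s (𝒯 k s) a Ek).action23 k U)
      (1 / (gOfRecord₁₃ F N θ.toStage13Params p k) ^ 2 * wilsonAction4 U) (-EkLog) (E₁ * (1 - L ^ (-β))⁻¹ + 1 + 2 * B₁ + E₂) Γ k :=
  have hL0 : 0 ≤ L := le_of_lt (lt_trans zero_lt_one hL)
  have hΓ0 : ∀ n, 1 ≤ n → n ≤ k → 0 ≤ Γ n := fun n hn hnk => (Nat.cast_nonneg _).trans (hΓ n hn hnk)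
  BalabanUVNodesN11Thm2Ineq249AtRecord13CoPHOfSect3Analysis.ineq249_action23_at_record₁₃CoPH_constCoupling_of_phi_eq_one θ p s (𝒯 k s) a κ₀ hκ Ek EkLog EkRest hEk U
    E₁ R₁ B₁ L β E₂ Γ hL hβ hE hR hΓ0 hφ1
    (fun j hj hjk => h243_mono_vol hE hL0 hj hΓ (h243_of_ineq243_keyed θ p 𝒯 𝒰 h243K hk s U hU j hj hjk))
    (fun j hj hjk => h244_mono_vol hR (hg j (hjk.trans hk)) hj hΓ (h244_of_ineq244_keyed θ p 𝒯 𝒰 h244K hk s U hU j hj hjk)) hsum hsmall h248 hvac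

open Classical in
/-- **★★ BOTH HALVES WITH THE CONSTANT COUPLING ALONG THE WITNESS CHAIN ON AN ALL-SMALL HISTORY** (`φ_j ≡ 1`), live-selector line: `(hσ, hT)` + provisos + Theorem 2 keyed to the
chain at a (2.41)(ii)-regular class ⇒ `∃ E₁ R₁ ≥ 0`, ∀ `k ≤ K`, all-small `s`, `U ∈ 𝒰 k s`, volumes dominating `|Γ_n(s)|` and `#ring_n(s)`, (2.46)'s inputs, vacuum ⇒
`Ineq249 (action23 of (s, chain witness, a, E_k) k U) ((1∕g_k²)·A(U)) (−EkLog) (E₁(1−L^{−β})⁻¹ + 1 + 2·θ.s2.lf.B₀·K₀(4·2^d,2d) + E₂) Γ k` — the 𝐁-side DISCHARGED; dag-n13-w3's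
`h249low` socket on the all-small branch. [cite: Balaban1988Convergent, (2.49)–(2.50) p.264, (2.24) p.259, Thm 1 p.262, Thm 2 p.263] -/
theorem ineq249_constCoupling_chainWitness_of_obligations_of_phi_eq_one (σ : Sect3Supplier θ p) (hprov : θ.Provisos₁₃CoPH F N)
    (hsel : θ.ppSel = ppSelLiveOfRecord F N θ.ν θ.τ9 (EOfRecord₁₃ F N θ.toStage13Params) (wOfRecord₉ F N θ.toStage9Params))
    (hθ : θ.Admissible F N) (hE₀ : 0 ≤ θ.s2.lf.E₀) (hB₀ : 0 ≤ θ.s2.lf.B₀) (hM : 1 ≤ θ.τ9.M)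
    (hκ : kappa₀ (4 * 2 ^ (F.P p.K).d) (2 * (F.P p.K).d) ≤ θ.s2.lf.κ)
    (hσ : SupplierObligations θ p σ) (hT : NoExpansionObligation θ p σ)
    (H033 : Flow → ℕ → Prop) {L β : ℝ} {κ₀ : ℕ}
    (hT2 : B14.Thm2Printed H033 (fun _ : PUnit => sect2DataOfRecord₁₃Keyed θ p (fun k s => (chainWitness θ p σ k).1 s) 𝒰) L β κ₀)
    (hβ1 : β < 1) (hβ0 : 0 < β) (hL : 1 < L) (hκ7 : 7 ≤ κ₀)
    (h033 : H033 (flowOfRun (gOfRecord₁₃ F N θ.toStage13Params p)) p.K) (hg : ∀ j, j ≤ p.K → 0 ≤ gOfRecord₁₃ F N θ.toStage13Params p j)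
    (h𝒰 : ∀ k (s : SeqOfRecord F θ.ν θ.τ9.M (gOfRecord₁₃ F N θ.toStage13Params p) p.K k) (U : GaugeField (F.P p.K) 0 (SU N)), U ∈ 𝒰 k s →
      ∀ j, 1 ≤ j → j ≤ k → ∀ X, Sect2.admB (F.P p.K) θ.ν θ.τ9.M (gOfRecord₁₃ F N θ.toStage13Params p) s.Ω s.Λ j (Sect2.domSites (F.P p.K) θ.τ9.M j X) = true →
        Sect2.ofBackgroundC (ιSU N) U ∈ Sect2.spaceMS (settingOfRecord₁₃ F N θ.toStage13Params p) (θ.rzAt p s) θ.τ9.M j (Sect2.domSites (F.P p.K) θ.τ9.M j X) s.Ω) :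
    ∃ E₁ R₁ : ℝ, 0 ≤ E₁ ∧ 0 ≤ R₁ ∧
      ∀ k, k ≤ p.K → ∀ (s : SeqOfRecord F θ.ν θ.τ9.M (gOfRecord₁₃ F N θ.toStage13Params p) p.K k) (U : GaugeField (F.P p.K) 0 (SU N)), U ∈ 𝒰 k s →
      (∀ j, 1 ≤ j → j ≤ k → ∀ x, θ.Phih p k s.Ω s.Λ j x = 1) →
      ∀ (a : Tk.SFluct (F.P p.K) (FluctV N)) (Ek EkLog EkRest : ℝ), Ek = EkLog + EkRest → ∀ (E₂ : ℝ) (Γ : ℕ → ℝ),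
      (∀ n, 1 ≤ n → n ≤ k → ((univ.filter fun y : Site (F.P p.K) n => toFine n y ∈ gammaRegion s.Ω k n).card : ℝ) ≤ Γ n) →
      (∀ n, 1 ≤ n → n ≤ k →
        ((univ.filter fun c : TPt (F.P p.K).d (Sect2.domCount (F.P p.K) θ.τ9.M n) =>
            (Sect2.domSites (F.P p.K) θ.τ9.M n (Sect2.cubeDom (F.P p.K) θ.τ9.M n c) ∩
                Sect2.enlT (F.P p.K) (Sect2.zSide (F.P p.K) θ.ν θ.τ9.M (gOfRecord₁₃ F N θ.toStage13Params p) n) 1 (s.Λ n)ᶜ).Nonempty ∧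
              ∃ c', (c' = c ∨ TAdj c' c) ∧ (Sect2.domSites (F.P p.K) θ.τ9.M n (Sect2.cubeDom (F.P p.K) θ.τ9.M n c') ∩ s.Ω n).Nonempty).card : ℝ) ≤ Γ n) →
      (∀ n, 1 ≤ n → n ≤ k → ∑ j ∈ Icc 1 n, (gOfRecord₁₃ F N θ.toStage13Params p j) ^ κ₀ ≤ (gOfRecord₁₃ F N θ.toStage13Params p n) ^ (κ₀ - 6)) →
      (∀ n, 1 ≤ n → n ≤ k → R₁ * (gOfRecord₁₃ F N θ.toStage13Params p n) ^ (κ₀ - 6) ≤ 1) →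
      VacuumRestBound EkRest E₂ Γ k →
      Ineq249 ((sect2ActionDataOfRecord F N (FluctV N) p.K (settingOfRecord₁₃ F N θ.toStage13Params p) (θ.rzAt p s) s ((chainWitness θ p σ k).1 s) a Ek).action23 k U)
        (1 / (gOfRecord₁₃ F N θ.toStage13Params p k) ^ 2 * wilsonAction4 U) (-EkLog)
        (E₁ * (1 - L ^ (-β))⁻¹ + 1 + 2 * (θ.s2.lf.B₀ * K₀ (4 * 2 ^ (F.P p.K).d) (2 * (F.P p.K).d)) + E₂) Γ k := by
  have hκ0 : 0 ≤ θ.s2.lf.κ := (kappa₀_nonneg (by positivity) _).trans hκ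
  obtain ⟨E₁, R₁, hE, hR, h243K, h244K⟩ :=
    exists_nonneg_constants_of_thm2Printed_keyed θ p (fun k s => (chainWitness θ p σ k).1 s) 𝒰 H033 hT2 hβ1 h033 (le_of_lt (lt_trans zero_lt_one hL)) hg
  refine ⟨E₁, R₁, hE, hR, fun k hk s U hU hφ1 a Ek EkLog EkRest hEk E₂ Γ hΓ hΓr hsum hsmall hvac => ?_⟩
  have hkmK : k ≤ (F.P p.K).m + (F.P p.K).K := by rw [T4Family.P_K]; omega
  have hform : ChainFormAt θ p σ k := chainFormAt_all_of_obligations hprov hsel hθ hκ0 hE₀ hB₀ hM σ hσ hT k hk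
  exact ineq249_constCoupling_of_ineq243_ineq244_keyed_of_phi_eq_one θ p (fun k s => (chainWitness θ p σ k).1 s) 𝒰 h243K h244K hL hβ0 hE hR hκ7 hk s U hU hg hφ1
    a Ek EkLog EkRest hEk _ E₂ Γ hΓ hsum hsmall (h248_chainWitness_of_chainFormAt θ p σ hform s a U hkmK hM hκ hB₀ (h𝒰 k s U hU) Γ hΓr) hvac

end Summit.QuantumFields.YangMills.Theorems.BalabanUVNodesN11Thm2AlongSupplyChainUpperHalf

end
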